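import Literature.AlgebraicGeometry.Motives.LocalSystemsFlatSectionsProofs
import HarnessLib

/-!
# Local systems spanned by flat sections: bases propagate, the monodromy is trivial, the local
# system is constant

Layer `Literature/AlgebraicGeometry/Motives`; sequel to `LocalSystems` (local systems as
functors on the fundamental groupoid, `transport`, `monodromyRep`, `flatSections`,
`flatSectionsEval`, `const`, `IsTrivial`) and `LocalSystemsFlatSectionsProofs`. Everything here
is PROVED; no named fact and no definition is introduced.

Motivation and source. In the proof of Cor. 1.5 of D. Arapura, *Hodge cycles and the Leray
filtration*, Pacific J. Math. 319 (2022) 233–258 = arXiv:2103.05038 (p. 5 of the held text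
`paper:arxiv-2103.05038`), the local system `R²f_*ℚ` of a family of `p_g = 0` surfaces over
`U` is trivialised by global algebraic sections: "Then `𝒵_i` is a relative divisor on `X/Y` such
that `[𝒵_i]` is equal to a multiple of `[Z_i]`. It follows that, after a finite base change,
`[𝒵_1], …, [𝒵_N]` gives a basis of `R²f_*ℚ`, i.e. an isomorphism `ℚ(-1)^N ≅ R²f_*ℚ`." The
classes `[𝒵_i]` are flat global sections of `R²f_*ℚ` over (a finite cover of) `U`, chosen to
restrict to a basis `[Z_1], …, [Z_N]` of ONE fibre `H²(X_y, ℚ)`; the sentence uses the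
following facts about local systems on a path-connected base (Deligne, *Équations
différentielles à points singuliers réguliers*, LNM 163 (1970), I.1, Cor. 1.4: a local system on
a connected, locally path-connected and locally simply connected space "is the same as" a
representation of `π₁`; Voisin, *Hodge Theory I*, §9.2 / Cor. 9.2.4 ff.: global sections =
monodromy invariants), which this file proves on the tree's carrier:

* `transport_apply_flatSection` — flat sections are transported into themselves (definition).
* `linearIndependent_flatSections_apply_of_joined`, `span_flatSections_apply_eq_top_of_joined`
  — **flat sections whose values at one point `s` are linearly independent (resp. span the
  fibre `V_s`) have linearly independent (resp. spanning) values at every point `t` joined to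
  `s`**: parallel transport `V_s ≃ V_t` along a path carries the values at `s` to the values at
  `t`. Hence "a basis of one fibre by flat sections is a basis of every fibre"
  (`span_flatSections_apply_eq_top`, `linearIndependent_flatSections_apply` on a path-connected
  base).
* `flatSectionsEval_surjective_of_span_eq_top`, `flatSectionsEval_surjective_of_joined`,
  `flatSectionsEval_bijective` — if flat sections span one fibre, evaluation
  `Γ(S, V) → V_t` is onto at every point of a path-connected base, hence bijective
  (`flatSectionsEval_injective`).
* `transport_loop_eq_id_of_flatSectionsEval_surjective`,
  `monodromyRep_eq_one_of_flatSectionsEval_surjective` — **then the monodromy representation is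
  trivial** (every vector of `V_s` extends to a flat section, which every loop fixes).
* `isTrivial_of_flatSectionsEval_bijective`, `isTrivial_of_span_flatSections_eq_top` — **and the
  local system is trivial**: evaluation of flat sections is a natural isomorphism
  `const(Γ(S, V)) ≅ V` ("an isomorphism `ℚ(-1)^N ≅ R²f_*ℚ`", forgetting the Hodge structure).

## References

* [Arapura2022] D. Arapura, Hodge cycles and the Leray filtration, Pacific J. Math. 319 (2022)
  233–258, doi:10.2140/pjm.2022.319.233 = arXiv:2103.05038, Cor. 1.5 (proof, p. 5 of the held
  text).
* [Deligne1970] P. Deligne, Équations différentielles à points singuliers réguliers, LNM 163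
  (1970), I.1 (1.1–1.4).
* [VoisinHodgeI2002] C. Voisin, Hodge Theory and Complex Algebraic Geometry I (CUP 2002), §9.2.
-/

open CategoryTheory

universe u w

namespace Literature.AlgebraicGeometry.Motives

namespace LocalSystem

section Ring

variable {R : Type u} [Ring R] {S : Type u} [TopologicalSpace S] (V : LocalSystem R S)

/-! ### Values of flat sections along paths -/

/-- A flat section is carried into itself by parallel transport: `γ_* (v s) = v t`
(the definition of `flatSections`). [cite: Deligne1970, I.1] -/
theorem transport_apply_flatSection (v : V.flatSections) {s t : S}
    (γ : Path.Homotopic.Quotient s t) :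
    V.transport γ ((v : ∀ s, V.fiber s) s) = (v : ∀ s, V.fiber s) t :=
  v.2 s t γ

/-- Parallel transport is injective (it is the linear equivalence `transportEquiv`).
[cite: Deligne1970, I.1.1] -/
theorem transport_injective {s t : S} (γ : Path.Homotopic.Quotient s t) :
    Function.Injective (V.transport γ) := by
  rw [← coe_transportEquiv]
  exact (V.transportEquiv γ).injective

/-- Parallel transport is surjective (it is the linear equivalence `transportEquiv`).
[cite: Deligne1970, I.1.1] -/
theorem transport_surjective {s t : S} (γ : Path.Homotopic.Quotient s t) :
    Function.Surjective (V.transport γ) := by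
  rw [← coe_transportEquiv]
  exact (V.transportEquiv γ).surjective

/-- The values at `t` of a family of flat sections are the transports along any path
`s ⟶ t` of their values at `s`. [cite: Deligne1970, I.1] -/
theorem flatSections_apply_eq_transport_comp {ι : Type w} (v : ι → V.flatSections) {s t : S}
    (γ : Path.Homotopic.Quotient s t) :
    (fun i ↦ (v i : ∀ s, V.fiber s) t) = V.transport γ ∘ fun i ↦ (v i : ∀ s, V.fiber s) s := by
  funext i
  exact (V.transport_apply_flatSection (v i) γ).symm

/-! ### A basis of one fibre by flat sections is a basis of every fibre -/

/-- **Linear independence of flat sections propagates along paths**: if the values at `s` of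
the flat sections `v i` are linearly independent, so are their values at any `t` joined to `s`
(transport `V_s ≃ V_t` along a path carries the ones to the others).
[cite: Arapura2022, Cor. 1.5 (proof)] [cite: Deligne1970, I.1] -/
theorem linearIndependent_flatSections_apply_of_joined {ι : Type w} (v : ι → V.flatSections)
    {s t : S} (h : Joined s t) (hli : LinearIndependent R fun i ↦ (v i : ∀ s, V.fiber s) s) :
    LinearIndependent R fun i ↦ (v i : ∀ s, V.fiber s) t := by
  obtain ⟨p⟩ := h
  rw [V.flatSections_apply_eq_transport_comp v ⟦p⟧]
  exact hli.map' (V.transport ⟦p⟧) (LinearMap.ker_eq_bot.2 (V.transport_injective ⟦p⟧))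

/-- **Spanning by flat sections propagates along paths**: if the values at `s` of the flat
sections `v i` span the fibre `V_s`, their values at any `t` joined to `s` span `V_t`.
[cite: Arapura2022, Cor. 1.5 (proof)] [cite: Deligne1970, I.1] -/
theorem span_flatSections_apply_eq_top_of_joined {ι : Type w} (v : ι → V.flatSections)
    {s t : S} (h : Joined s t)
    (hsp : Submodule.span R (Set.range fun i ↦ (v i : ∀ s, V.fiber s) s) = ⊤) :
    Submodule.span R (Set.range fun i ↦ (v i : ∀ s, V.fiber s) t) = ⊤ := by
  obtain ⟨p⟩ := h
  rw [V.flatSections_apply_eq_transport_comp v ⟦p⟧, Set.range_comp, ← Submodule.map_span, hsp,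
    Submodule.map_top, LinearMap.range_eq_top]
  exact V.transport_surjective ⟦p⟧

/-- On a path-connected base: flat sections linearly independent at one point are linearly
independent at every point. [cite: Arapura2022, Cor. 1.5 (proof)] [cite: Deligne1970, I.1] -/
theorem linearIndependent_flatSections_apply [PathConnectedSpace S] {ι : Type w}
    (v : ι → V.flatSections) (s t : S)
    (hli : LinearIndependent R fun i ↦ (v i : ∀ s, V.fiber s) s) :
    LinearIndependent R fun i ↦ (v i : ∀ s, V.fiber s) t :=
  V.linearIndependent_flatSections_apply_of_joined v (PathConnectedSpace.joined s t) hli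

/-- On a path-connected base: flat sections spanning the fibre at one point span the fibre at
every point — "`[𝒵_1], …, [𝒵_N]` gives a basis of `R²f_*ℚ`" once they give a basis of one
`H²(X_y, ℚ)`. [cite: Arapura2022, Cor. 1.5 (proof)] [cite: Deligne1970, I.1] -/
theorem span_flatSections_apply_eq_top [PathConnectedSpace S] {ι : Type w}
    (v : ι → V.flatSections) (s t : S)
    (hsp : Submodule.span R (Set.range fun i ↦ (v i : ∀ s, V.fiber s) s) = ⊤) :
    Submodule.span R (Set.range fun i ↦ (v i : ∀ s, V.fiber s) t) = ⊤ :=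
  V.span_flatSections_apply_eq_top_of_joined v (PathConnectedSpace.joined s t) hsp

/-! ### Evaluation of flat sections is then onto every fibre -/

/-- If some flat sections span the fibre `V_s`, evaluation `Γ(S, V) → V_s` is onto. [folklore] -/
theorem flatSectionsEval_surjective_of_span_eq_top {ι : Type w} (v : ι → V.flatSections) (s : S)
    (hsp : Submodule.span R (Set.range fun i ↦ (v i : ∀ s, V.fiber s) s) = ⊤) :
    Function.Surjective (V.flatSectionsEval s) := by
  rw [← LinearMap.range_eq_top, eq_top_iff, ← hsp, Submodule.span_le]
  rintro _ ⟨i, rfl⟩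
  exact ⟨v i, rfl⟩

/-- **Surjectivity of evaluation propagates along paths**: if every vector of `V_s` is the value
of a flat section, so is every vector of `V_t` for `t` joined to `s` (transport it back to `s`,
extend, and use that transport is injective). [cite: Deligne1970, Cor. I.1.4] -/
theorem flatSectionsEval_surjective_of_joined {s t : S} (h : Joined s t)
    (hs : Function.Surjective (V.flatSectionsEval s)) :
    Function.Surjective (V.flatSectionsEval t) := by
  obtain ⟨p⟩ := h
  intro x
  obtain ⟨v, hv⟩ := hs (V.transport ⟦p.symm⟧ x)
  refine ⟨v, V.transport_injective ⟦p.symm⟧ ?_⟩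
  rw [flatSectionsEval_apply, transport_apply_flatSection, ← hv, flatSectionsEval_apply]

/-- On a path-connected base, if evaluation of flat sections is onto one fibre it is onto every
fibre. [cite: Deligne1970, Cor. I.1.4] -/
theorem flatSectionsEval_surjective [PathConnectedSpace S] {s : S}
    (hs : Function.Surjective (V.flatSectionsEval s)) (t : S) :
    Function.Surjective (V.flatSectionsEval t) :=
  V.flatSectionsEval_surjective_of_joined (PathConnectedSpace.joined s t) hs

/-- … hence bijective at every point (injectivity: `flatSectionsEval_injective`, a flat section
on a path-connected base is determined by one value). [cite: Deligne1970, Cor. I.1.4] -/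
theorem flatSectionsEval_bijective [PathConnectedSpace S] {s : S}
    (hs : Function.Surjective (V.flatSectionsEval s)) (t : S) :
    Function.Bijective (V.flatSectionsEval t) :=
  ⟨V.flatSectionsEval_injective t, V.flatSectionsEval_surjective hs t⟩

/-! ### The monodromy is then trivial -/

/-- **If every vector of `V_s` extends to a flat section, every loop at `s` acts trivially on
`V_s`** (a flat section is fixed by transport along every path class).
[cite: Deligne1970, Cor. I.1.4] -/
theorem transport_loop_eq_id_of_flatSectionsEval_surjective {s : S}
    (hs : Function.Surjective (V.flatSectionsEval s)) (γ : Path.Homotopic.Quotient s s) :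
    V.transport γ = LinearMap.id := by
  ext x
  obtain ⟨v, rfl⟩ := hs x
  rw [LinearMap.id_apply, flatSectionsEval_apply]
  exact V.transport_apply_flatSection v γ

/-- **The monodromy representation of a local system spanned by flat sections is trivial**:
`ρ(γ) = 1` for every `γ ∈ π₁(S, s)`. [cite: Deligne1970, Cor. I.1.4] -/
theorem monodromyRep_eq_one_of_flatSectionsEval_surjective {s : S}
    (hs : Function.Surjective (V.flatSectionsEval s)) (γ : FundamentalGroup S s) :
    V.monodromyRep s γ = 1 := by
  rw [monodromyRep_apply, V.transport_loop_eq_id_of_flatSectionsEval_surjective hs]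
  rfl

/-- The same from spanning flat sections `v i` at `s`. [cite: Arapura2022, Cor. 1.5 (proof)]
[cite: Deligne1970, Cor. I.1.4] -/
theorem monodromyRep_eq_one_of_span_flatSections_eq_top {ι : Type w} (v : ι → V.flatSections)
    {s : S} (hsp : Submodule.span R (Set.range fun i ↦ (v i : ∀ s, V.fiber s) s) = ⊤)
    (γ : FundamentalGroup S s) : V.monodromyRep s γ = 1 :=
  V.monodromyRep_eq_one_of_flatSectionsEval_surjective
    (V.flatSectionsEval_surjective_of_span_eq_top v s hsp) γ

/-! ### … and the local system is trivial -/

/-- **A local system whose flat sections evaluate bijectively onto every fibre is trivial**: the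
evaluations `Γ(S, V) → V_s` are the components of a natural isomorphism from the constant local
system with fibre `Γ(S, V)` to `V` (naturality = flatness), so `V ≅ const Γ(S, V)`.
[cite: Deligne1970, Cor. I.1.4] -/
theorem isTrivial_of_flatSectionsEval_bijective
    (h : ∀ s, Function.Bijective (V.flatSectionsEval s)) : V.IsTrivial := by
  refine ⟨ModuleCat.of R V.flatSections, ⟨(NatIso.ofComponents (fun X ↦
    (LinearEquiv.ofBijective (V.flatSectionsEval X.as) (h X.as)).toModuleIso) ?_).symm⟩⟩
  intro X Y f
  refine ModuleCat.hom_ext (LinearMap.ext fun (v : V.flatSections) ↦ ?_)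
  have hc : ((const R S (ModuleCat.of R V.flatSections)).map f).hom v = v := rfl
  rw [ModuleCat.hom_comp, ModuleCat.hom_comp, LinearMap.comp_apply, LinearMap.comp_apply, hc]
  change (v : ∀ s, V.fiber s) Y.as = (V.map f).hom ((v : ∀ s, V.fiber s) X.as)
  exact (V.transport_apply_flatSection v (show Path.Homotopic.Quotient X.as Y.as from f)).symm

/-- On a path-connected base, a local system whose flat sections evaluate onto ONE fibre is
trivial. [cite: Deligne1970, Cor. I.1.4] -/
theorem isTrivial_of_flatSectionsEval_surjective [PathConnectedSpace S] {s : S}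
    (hs : Function.Surjective (V.flatSectionsEval s)) : V.IsTrivial :=
  V.isTrivial_of_flatSectionsEval_bijective (V.flatSectionsEval_bijective hs)

/-- **Arapura 2022, proof of Cor. 1.5, "`[𝒵_1], …, [𝒵_N]` gives a basis of `R²f_*ℚ`, i.e. an
isomorphism `ℚ(-1)^N ≅ R²f_*ℚ`"** — the statement about local systems behind it: on a
path-connected base, a local system admitting flat global sections whose values span the fibre
at one point is trivial (isomorphic to the constant local system on its flat sections), its
monodromy is trivial (`monodromyRep_eq_one_of_span_flatSections_eq_top`), and those sections
span every fibre (`span_flatSections_apply_eq_top`), forming a basis everywhere if they do at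
one point (`linearIndependent_flatSections_apply`). (The Tate twist `ℚ(-1)` records the Hodge
type of divisor classes and is not part of the local-system statement.)
[cite: Arapura2022, Cor. 1.5 (proof)] [cite: Deligne1970, Cor. I.1.4] -/
theorem isTrivial_of_span_flatSections_eq_top [PathConnectedSpace S] {ι : Type w}
    (v : ι → V.flatSections) (s : S)
    (hsp : Submodule.span R (Set.range fun i ↦ (v i : ∀ s, V.fiber s) s) = ⊤) : V.IsTrivial :=
  V.isTrivial_of_flatSectionsEval_surjective (V.flatSectionsEval_surjective_of_span_eq_top v s hsp)

end Ring

/-! ### Sanity checks -/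

section Sanity

variable {R : Type u} [Ring R] {S : Type u} [TopologicalSpace S]

/-- Non-vacuity: for the constant local system with fibre `M`, the constant families are flat
sections, they evaluate onto every fibre, and the theorems return the (known) triviality of
`const` — the hypotheses are satisfiable. -/
example (M : ModuleCat.{u} R) (s : S) : Function.Surjective ((const R S M).flatSectionsEval s) := by
  intro x
  exact ⟨⟨fun _ ↦ x, fun _ _ _ ↦ rfl⟩, rfl⟩

example [PathConnectedSpace S] (M : ModuleCat.{u} R) (s : S) : (const R S M).IsTrivial :=
  (const R S M).isTrivial_of_flatSectionsEval_surjective (s := s) fun x ↦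
    ⟨⟨fun _ ↦ x, fun _ _ _ ↦ rfl⟩, rfl⟩

end Sanity

end LocalSystem

end Literature.AlgebraicGeometry.Motives
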